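import Mathlib
import Summits.ValiantsHypothesis.ValiantsHypothesis.Theses.ValuativeGCT

/-!
# `ValuativeGCT.Assembly` (stmt-ValiantsHypothesis-12630) — assembly of route ValuativeGCT

The route's assembly item `Assembly`:
`ValuativeBound → ValuativeFlip → GctMultPrinciple → GctToVH → ValiantsHypothesis`.
This is pure logic and is literally the type of the route's (sorry-free) deciding theorem
`Summit.ValiantsHypothesis.ValiantsHypothesis.Theses.ValuativeGCT.closes`: `ValuativeFlip` gives, for
every exponent `c`, a threshold beyond which every `m` in the quasi-polynomial window carries a
subspace `U`, a rank cut `r`, a degree `δ` and a partition `λ` with `dim T_U(λ) < mult_λ ℂ[Δ(pp_{n,m})]_δ`;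
`ValuativeBound` gives `mult_λ ℂ[Δ(det_m)]_δ ≤ dim T_U(λ)`; `GctMultPrinciple` turns the resulting
multiplicity flip into `pp_{n,m} ∉ Δ(det_m)`; and `GctToVH` (the quasi-polynomial Mulmuley–Sohoni
thesis implies Valiant's hypothesis) concludes. Mulmuley–Sohoni 2001 §4; arXiv:0907.2850. [folklore]
-/

namespace Summit.ValiantsHypothesis.ValiantsHypothesis.Theorems

-- `Summit.ValiantsHypothesis.ValiantsHypothesis.…` is the tree's mandated single-conjunct layout (Sub = Summit).
set_option linter.dupNamespace false

/-- **`Assembly` holds** (item stmt-ValiantsHypothesis-12630, assembly of route ValuativeGCT):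
`ValuativeBound → ValuativeFlip → GctMultPrinciple → GctToVH → ValiantsHypothesis`.
Pure logic — exactly the route's deciding theorem `ValuativeGCT.closes` (Flip supplies
`(U, r, δ, λ)` with `dim T_U(λ) < mult_λ(pp)`, Bound gives `mult_λ(det) ≤ dim T_U(λ)`, the
multiplicity-obstruction principle gives non-membership in the window, `GctToVH` concludes).
[folklore] -/
theorem assembly_proof :
    Summit.ValiantsHypothesis.ValiantsHypothesis.Theses.ValuativeGCT.Assembly := by
  -- buildfix lane 2026-08-19 (ops-buildfix): the route was CLOSED (exhausted, 2026-08-17T15:37Z) and the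
  -- gate stripped its deciding theorem `closes`, which this accepted proof invoked; the same pure-logic
  -- composition is now written out (statement unchanged).
  unfold Summit.ValiantsHypothesis.ValiantsHypothesis.Theses.ValuativeGCT.Assembly
  intro hBound hFlip hMult hVH
  refine hVH fun c => ?_
  obtain ⟨n₀, hn₀⟩ := hFlip c
  refine ⟨n₀, fun n hn m _ hnm hm => ?_⟩
  obtain ⟨U, r, δ, lam, hU, hlam, hlt⟩ := hn₀ n hn m hnm hm
  exact hMult n m _ hnm (lt_of_le_of_lt (hBound m U r hU δ lam hlam) hlt)

end Summit.ValiantsHypothesis.ValiantsHypothesis.Theorems
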